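import Summits.QuantumFields.YangMills.Theorems.AllWindowsColdBoxBulkMidSandwichLocalisedQuartic

/-!
# The OFF-CORE second moment of an affine field under the sandwich
# (crux idea `logconcave-core-extension` on ⟨stmt-QuantumFields-24006⟩ — toward a LOCALISED quadratic
# covariance comparison at the core constant `r_K`)

Whitened frame, `A ∈ C²(ℝⁿ)` with the global second-difference sandwich (`δ < 1`) and the centring
`∫ x_i e^{−A} = 0`; `Z = ∫e^{−A}`, `W = Σ_i|H_i|²/(1−δ) + |b|²`:

* `le_zero_of_forall_le_div`, `le_sqrt_mul_of_forall_amgm` : the optimisation step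
  `X ≤ (sP + M/s)/2 ∀ s > 0 ⇒ X ≤ √(PM)`;
* `setIntegral_affine_normSq_le` : **`∫_S |Hx+b|² e^{−A} ≤ 14·W·√((∫_S e^{−A})·Z)`** for every measurable `S`
  (Cauchy–Schwarz against the quartic moment `integral_affine_normSq_sq_le`, `√184 < 14`) — the only place
  where the Gibbs mass of the complement of the core enters the localised variance ceiling / floor.

HONEST SCOPE.  Free-hands work of the LEAD seat of ⟨stmt-QuantumFields-24006⟩ (FCL lineage) on an ingredient
of an UN-TRIAGED crux idea card; classical log-concave probability.  No stub of LINE-18, no crux, rung or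
summit is proved; the Yang–Mills mass gap is NOT proved by any of this.
-/

noncomputable section

namespace Summit.QuantumFields.YangMills.Theorems.SandwichVariancePinching

open MeasureTheory Real Filter Topology Set

variable {n : ℕ}

/-! ## §3 The off-core second moment -/

/-- If `X ≤ K / s` for every `s > 0` (`K ≥ 0`) then `X ≤ 0`. [folklore] -/
theorem le_zero_of_forall_le_div {X K : ℝ} (hK : 0 ≤ K) (h : ∀ s : ℝ, 0 < s → X ≤ K / s) : X ≤ 0 := by
  by_contra hX
  push Not at hX
  have hs : 0 < 2 * (K + 1) / X := by positivity
  have h1 := h (2 * (K + 1) / X) hs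
  have h2 : K / (2 * (K + 1) / X) = X * (K / (2 * (K + 1))) := by field_simp
  have h3 : K / (2 * (K + 1)) ≤ 1 / 2 := by rw [div_le_iff₀ (by positivity)]; linarith
  rw [h2] at h1
  nlinarith

/-- **AM–GM OPTIMISATION**: if `X ≤ (s·P + M/s)/2` for every `s > 0` (`P, M ≥ 0`) then `X ≤ √(P·M)`.
[folklore] -/
theorem le_sqrt_mul_of_forall_amgm {X P M : ℝ} (hP : 0 ≤ P) (hM : 0 ≤ M)
    (h : ∀ s : ℝ, 0 < s → X ≤ (s * P + M / s) / 2) : X ≤ Real.sqrt (P * M) := by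
  rcases hP.lt_or_eq with hPpos | hP0
  · rcases hM.lt_or_eq with hMpos | hM0
    · set s : ℝ := Real.sqrt (M / P) with hs
      have hspos : 0 < s := Real.sqrt_pos.mpr (div_pos hMpos hPpos)
      have hss : s * s = M / P := Real.mul_self_sqrt (div_pos hMpos hPpos).le
      have h1 := h s hspos
      have hsP : s * P = Real.sqrt (P * M) := by
        have e1 : (s * P) * (s * P) = P * M := by
          calc (s * P) * (s * P) = (s * s) * P * P := by ring
            _ = M / P * P * P := by rw [hss]
            _ = P * M := by field_simp
        have hnn : 0 ≤ s * P := mul_nonneg hspos.le hP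
        rw [← Real.sqrt_mul_self hnn, e1]
      have hMs : M / s = Real.sqrt (P * M) := by
        rw [div_eq_iff hspos.ne', ← hsP]
        calc M = M / P * P := by field_simp
          _ = s * s * P := by rw [hss]
          _ = s * P * s := by ring
      rw [hsP, hMs] at h1
      linarith
    · -- `M = 0`: let `s → 0`
      have hX : X ≤ 0 := by
        refine le_zero_of_forall_le_div (K := P / 2) (by positivity) fun s hs => ?_
        have h1 := h s⁻¹ (inv_pos.mpr hs)
        rw [← hM0, zero_div, add_zero] at h1
        calc X ≤ s⁻¹ * P / 2 := h1
          _ = P / 2 / s := by field_simp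
      rw [← hM0, mul_zero, Real.sqrt_zero]; exact hX
  · -- `P = 0`: let `s → ∞`
    have hX : X ≤ 0 := by
      refine le_zero_of_forall_le_div (K := M / 2) (by positivity) fun s hs => ?_
      have h1 := h s hs
      rw [← hP0, mul_zero, zero_add] at h1
      calc X ≤ M / s / 2 := h1
        _ = M / 2 / s := by ring
    rw [← hP0, zero_mul, Real.sqrt_zero]; exact hX

/-- **THE OFF-CORE SECOND MOMENT OF AN AFFINE FIELD**: for every measurable `S`,
`∫_S |Hx+b|² e^{−A} ≤ 14·(Σ_i|H_i|²/(1−δ) + |b|²)·√((∫_S e^{−A})·∫e^{−A})` — Cauchy–Schwarz against the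
quartic moment `integral_affine_normSq_sq_le` (`√184 < 14`). [folklore] -/
theorem setIntegral_affine_normSq_le {A : (Fin n → ℝ) → ℝ} (hA : ContDiff ℝ 2 A) {δ : ℝ} (hδ1 : δ < 1)
    (hsw : ∀ x h : Fin n → ℝ, (1 - δ) * (h ⬝ᵥ h) ≤ A (x + h) + A (x - h) - 2 * A x ∧
      A (x + h) + A (x - h) - 2 * A x ≤ (1 + δ) * (h ⬝ᵥ h))
    (hcent : ∀ i : Fin n, ∫ x, x i * exp (-A x) = 0) (H : Matrix (Fin n) (Fin n) ℝ) (b : Fin n → ℝ)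
    {S : Set (Fin n → ℝ)} (hS : MeasurableSet S) :
    ∫ x in S, ((H.mulVec x + b) ⬝ᵥ (H.mulVec x + b)) * exp (-A x) ≤
      14 * ((∑ i, H i ⬝ᵥ H i) / (1 - δ) + b ⬝ᵥ b) *
        Real.sqrt ((∫ x in S, exp (-A x)) * ∫ x, exp (-A x)) := by
  have hAc : Continuous A := hA.continuous
  obtain ⟨C₀, κ, _, hκ, hlb⟩ := exists_quadratic_lower_of_sandwich hAc hδ1 hsw
  have hZint : Integrable fun x => exp (-A x) := by
    have := integrable_mul_exp_neg_of_growth hAc continuous_const hκ (by norm_num : 0 ≤ 8) hlb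
      (w := fun _ => (1:ℝ)) (D := 1) (fun x => by simp)
    simpa using this
  have hZ0 : 0 ≤ ∫ x, exp (-A x) := integral_nonneg fun x => (exp_pos _).le
  have h1δ : 0 < 1 - δ := by linarith
  set W : ℝ := (∑ i, H i ⬝ᵥ H i) / (1 - δ) + b ⬝ᵥ b with hW
  have hW0 : 0 ≤ W := add_nonneg (div_nonneg (Finset.sum_nonneg fun i _ => by
    simpa using dotProduct_self_star_nonneg (H i)) h1δ.le) (by simpa using dotProduct_self_star_nonneg b)
  set P : ℝ := ∫ x in S, exp (-A x) with hP
  set M : ℝ := ∫ x, ((H.mulVec x + b) ⬝ᵥ (H.mulVec x + b)) ^ 2 * exp (-A x) with hM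
  have hP0 : 0 ≤ P := setIntegral_nonneg hS fun x _ => (exp_pos _).le
  have hM0 : 0 ≤ M := integral_nonneg fun x => mul_nonneg (sq_nonneg _) (exp_pos _).le
  have hM4 : M ≤ 184 * W ^ 2 * ∫ x, exp (-A x) := integral_affine_normSq_sq_le hA hδ1 hsw hcent H b
  -- integrability of `|u|² e^{−A}` and `|u|⁴ e^{−A}`
  obtain ⟨Cu, hCu0, hCu⟩ := exists_norm_affine_le H b
  have hn : (0:ℝ) ≤ n := Nat.cast_nonneg n
  have huu_le : ∀ x, (H.mulVec x + b) ⬝ᵥ (H.mulVec x + b) ≤ (n : ℝ) * Cu ^ 2 * (1 + ‖x‖) ^ 2 := by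
    intro x
    have huub : ‖H.mulVec x + b‖ ^ 2 ≤ Cu ^ 2 * (1 + ‖x‖) ^ 2 := by
      rw [← mul_pow]; exact pow_le_pow_left₀ (norm_nonneg _) (hCu x) 2
    nlinarith [dotProduct_self_le_card_mul_norm_sq (H.mulVec x + b), mul_le_mul_of_nonneg_left huub hn]
  have huu0 : ∀ x, 0 ≤ (H.mulVec x + b) ⬝ᵥ (H.mulVec x + b) := fun x => by
    simpa using dotProduct_self_star_nonneg (H.mulVec x + b)
  have hcont : Continuous fun x => (H.mulVec x + b) ⬝ᵥ (H.mulVec x + b) :=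
    ((contDiff_affine H b).continuous).dotProduct (contDiff_affine H b).continuous
  have hI2 : Integrable fun x => ((H.mulVec x + b) ⬝ᵥ (H.mulVec x + b)) * exp (-A x) := by
    refine integrable_mul_exp_neg_of_growth hAc hcont hκ (by norm_num : 2 ≤ 8) hlb
      (D := (n : ℝ) * Cu ^ 2) fun x => ?_
    rw [abs_of_nonneg (huu0 x)]; exact huu_le x
  have hI4 : Integrable fun x => ((H.mulVec x + b) ⬝ᵥ (H.mulVec x + b)) ^ 2 * exp (-A x) := by
    refine integrable_mul_exp_neg_of_growth hAc (hcont.pow 2) hκ (by norm_num : 4 ≤ 8) hlb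
      (D := ((n : ℝ) * Cu ^ 2) ^ 2) fun x => ?_
    rw [abs_of_nonneg (sq_nonneg _)]
    calc ((H.mulVec x + b) ⬝ᵥ (H.mulVec x + b)) ^ 2 ≤ ((n : ℝ) * Cu ^ 2 * (1 + ‖x‖) ^ 2) ^ 2 :=
          pow_le_pow_left₀ (huu0 x) (huu_le x) 2
      _ = ((n : ℝ) * Cu ^ 2) ^ 2 * (1 + ‖x‖) ^ 4 := by ring
  -- AM–GM for every `s > 0`
  have hamgm : ∀ s : ℝ, 0 < s →
      (∫ x in S, ((H.mulVec x + b) ⬝ᵥ (H.mulVec x + b)) * exp (-A x)) ≤ (s * P + M / s) / 2 := by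
    intro s hs
    have hpt : ∀ x, x ∈ S → ((H.mulVec x + b) ⬝ᵥ (H.mulVec x + b)) * exp (-A x) ≤
        (s * exp (-A x) + ((H.mulVec x + b) ⬝ᵥ (H.mulVec x + b)) ^ 2 * exp (-A x) / s) / 2 := by
      intro x _
      set q := (H.mulVec x + b) ⬝ᵥ (H.mulVec x + b)
      have he : 0 ≤ exp (-A x) := (exp_pos _).le
      -- `q ≤ (s + q²/s)/2`
      have hq : q ≤ (s + q ^ 2 / s) / 2 := by
        have : 0 ≤ (q - s) ^ 2 / s := div_nonneg (sq_nonneg _) hs.le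
        have e : (s + q ^ 2 / s) / 2 - q = (q - s) ^ 2 / s / 2 := by field_simp; ring
        linarith
      have := mul_le_mul_of_nonneg_right hq he
      calc q * exp (-A x) ≤ (s + q ^ 2 / s) / 2 * exp (-A x) := this
        _ = (s * exp (-A x) + q ^ 2 * exp (-A x) / s) / 2 := by ring
    have hIr : IntegrableOn (fun x => (s * exp (-A x) +
        ((H.mulVec x + b) ⬝ᵥ (H.mulVec x + b)) ^ 2 * exp (-A x) / s) / 2) S volume :=
      (((hZint.const_mul s).add (hI4.div_const s)).div_const 2).integrableOn
    calc (∫ x in S, ((H.mulVec x + b) ⬝ᵥ (H.mulVec x + b)) * exp (-A x))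
        ≤ ∫ x in S, (s * exp (-A x) + ((H.mulVec x + b) ⬝ᵥ (H.mulVec x + b)) ^ 2 * exp (-A x) / s) / 2 :=
          setIntegral_mono_on hI2.integrableOn hIr hS hpt
      _ = (s * P + (∫ x in S, ((H.mulVec x + b) ⬝ᵥ (H.mulVec x + b)) ^ 2 * exp (-A x)) / s) / 2 := by
          rw [integral_div, integral_add (hZint.const_mul s).integrableOn (hI4.div_const s).integrableOn,
            integral_const_mul, integral_div]
      _ ≤ (s * P + M / s) / 2 := by
          have hsub : (∫ x in S, ((H.mulVec x + b) ⬝ᵥ (H.mulVec x + b)) ^ 2 * exp (-A x)) ≤ M :=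
            setIntegral_le_integral hI4 (ae_of_all _ fun x => mul_nonneg (sq_nonneg _) (exp_pos _).le)
          have := div_le_div_of_nonneg_right hsub hs.le
          linarith
  have hX := le_sqrt_mul_of_forall_amgm hP0 hM0 hamgm
  -- `√(P M) ≤ √(P · 184 W² Z) = √184 · W · √(P Z) ≤ 14 W √(P Z)`
  have hPM : P * M ≤ P * (184 * W ^ 2 * ∫ x, exp (-A x)) := mul_le_mul_of_nonneg_left hM4 hP0
  calc (∫ x in S, ((H.mulVec x + b) ⬝ᵥ (H.mulVec x + b)) * exp (-A x)) ≤ Real.sqrt (P * M) := hX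
    _ ≤ Real.sqrt (P * (184 * W ^ 2 * ∫ x, exp (-A x))) := Real.sqrt_le_sqrt hPM
    _ = Real.sqrt 184 * W * Real.sqrt (P * ∫ x, exp (-A x)) := by
        have e : P * (184 * W ^ 2 * ∫ x, exp (-A x)) = (184 * W ^ 2) * (P * ∫ x, exp (-A x)) := by ring
        rw [e, Real.sqrt_mul (by positivity), Real.sqrt_mul (by norm_num), Real.sqrt_sq hW0]
    _ ≤ 14 * W * Real.sqrt (P * ∫ x, exp (-A x)) := by
        have h14 : Real.sqrt 184 ≤ 14 := by
          rw [Real.sqrt_le_left (by norm_num)]; norm_num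
        have hnn : 0 ≤ W * Real.sqrt (P * ∫ x, exp (-A x)) := mul_nonneg hW0 (Real.sqrt_nonneg _)
        nlinarith

end Summit.QuantumFields.YangMills.Theorems.SandwichVariancePinching

end
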